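import Literature.AnabelianGeometry.AbsoluteAnabelian.NeukirchUchidaGaloisInvariance
import Mathlib.FieldTheory.Galois.Infinite
import HarnessLib

/-!
# The Neukirch–Uchida deduction, row R6 (instance-free consumption form): `α(W) = W` for an OPEN NORMAL
# subgroup `W ≤ G_ℚ`

Companion of `NeukirchUchidaGaloisInvariance.lean` (abc-iut-w6-d108; sub-DAG `plan/L4/SUBDAG-NeukirchUchida.md`
row R6, holder abc-iut-L4-d2).  J. Neukirch, A. Schmidt, K. Wingberg, *Cohomology of Number Fields*, proof of
Thm. (12.2.1), step «`σ(G(Ω|N)) = G(Ω|N)` for every finite Galois `N/ℚ`»: there the level is `M : IntermediateField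
ℚ ℚ̄` with class binders `[FiniteDimensional ℚ M] [IsGalois ℚ M]`.  AT BASE `ℚ` such binders hit the
`ℚ`-ALGEBRA DIAMOND: the `ℚ`-algebra structure on a subfield `↥M ⊆ ℚ̄` found by instance search is
`DivisionRing.toRatAlgebra`, definitionally but NOT reducibly equal to `IntermediateField.algebra`, so an
`IsGalois ℚ ↥M` produced by Mathlib's Galois correspondence does not synthesise against the binder
(abc-iut-L4-d2 RESHAPE 2026-08-26T13:53Z, verified in a probe).  This PROOF-ONLY file (no `def`) restates R6 in
the INSTANCE-FREE currency the holder asked for: the level is an OPEN NORMAL SUBGROUP `W ≤ Γ = G_ℚ`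
(«`W = Gal(ℚ̄/M)`, `M/ℚ` finite Galois»), the row-R4 data are taken AT `K_W = KV W` (abc-iut-w6-d055's `KV`),
and the Galois instances are manufactured inside the proofs.

* `isGalois_KV_of_normal` — `K_W/ℚ` is Galois for `W` open normal (`InfiniteGalois.normal_iff_isGalois` through
  `Γ_{K_W} = W`), returned as a term;
* **`map_subgroupOf_eq_of_isOpen_normal`** — `α : U₁ ≃* U₂`, `W` open normal, `W₂ = α(W ∩ U₁)` read in `Γ` and
  closed, `finrank ℚ K_W = finrank ℚ K_{W₂}`, degree-one primes transfer from `K_{W₂}` to `K_W`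
  ⊢ `(W.subgroupOf U₁).map α = W.subgroupOf U₂`; `eq_of_isOpen_normal_of_bauer` — `W = W₂`;
* **`map_subgroupOf_eq_of_isOpen_normal_of_continuousMulEquiv`** — the same for a topological
  `α : U₁ ≃ₜ* U₂` with `W ≤ U₁` (closedness of `W₂` automatic), together with `W ≤ U₂`.

HONEST FRAMING: classical algebraic number theory / infinite Galois theory, outside the [IUTchIII] Cor. 3.12
cone; the R4 data are hypotheses; nothing here takes a side.

## References
* [NeukirchSchmidtWingberg2008] Neukirch–Schmidt–Wingberg, *Cohomology of Number Fields*, Thm (12.2.1) and its proof.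
* [NeukirchANT1999] J. Neukirch, *Algebraic Number Theory*, Ch. VII Prop. (13.9) (M. Bauer); Ch. IV §1.
-/

noncomputable section

open scoped Pointwise Topology NumberField
open Field Filter NumberField IsDedekindDomain

namespace Literature.AnabelianGeometry.AbsoluteAnabelian

namespace NeukirchUchidaProof

open Literature.NumberTheory.GaloisRepresentations Literature.NumberTheory.NumberFields

section InstanceFree

variable {U₁ U₂ : Subgroup (absoluteGaloisGroup ℚ)}

/-- For an OPEN NORMAL subgroup `W ≤ Γ = G_ℚ` the fixed field `K_W ⊆ ℚ̄` is Galois over `ℚ` (infinite Galois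
correspondence, Mathlib `InfiniteGalois.normal_iff_isGalois`, through `Γ_{K_W} = W`).  Returned as a
term, to be installed with `haveI`. [cite: NeukirchANT1999, Ch. IV §1] -/
theorem isGalois_KV_of_normal (W : Subgroup (absoluteGaloisGroup ℚ))
    (hWo : IsOpen (W : Set (absoluteGaloisGroup ℚ))) (hWn : W.Normal) : IsGalois ℚ (KV W) := by
  haveI : IsGalois ℚ (AlgebraicClosure ℚ) :=
    @IsAlgClosure.isGalois ℚ (AlgebraicClosure ℚ) _ _ (AlgebraicClosure.instAlgebra ℚ) inferInstance inferInstance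
  -- `(K_W).fixingSubgroup = W` read in `Gal(ℚ̄/ℚ)` through the identity `toAlgEquiv ℚ`
  have h1 : (KV W).fixingSubgroup = W.map (absoluteGaloisGroup.toAlgEquiv ℚ).toMonoidHom := by
    have h := ΓK_KV W hWo
    rw [ΓK_eq_comap] at h
    have h' := congrArg (Subgroup.map (absoluteGaloisGroup.toAlgEquiv ℚ).toMonoidHom) h
    rwa [Subgroup.map_comap_eq_self_of_surjective (absoluteGaloisGroup.toAlgEquiv ℚ).surjective] at h'
  have h2 : (KV W).fixingSubgroup.Normal := by
    rw [h1]
    exact Subgroup.Normal.map hWn _ (absoluteGaloisGroup.toAlgEquiv ℚ).surjective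
  exact (InfiniteGalois.normal_iff_isGalois (KV W)).mp h2

/-- **R6 GALOIS-INVARIANCE, instance-free consumption form.**  `Γ = G_ℚ`, `U₁ U₂ ≤ Γ`, `α : U₁ ≃* U₂`;
`W ≤ Γ` an OPEN NORMAL subgroup («`W = Gal(ℚ̄/M)`, `M/ℚ` finite Galois»); `W₂ ≤ Γ` the image
`α(W ∩ U₁)` read in `Γ`, assumed closed (automatic for a topological `α` and `W ≤ U₁`, next theorem); the
row-R4 data AT `K_W`: `hdeg : finrank ℚ K_W = finrank ℚ K_{W₂}` and `hP₁` (a prime with a degree-one divisor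
in `K_{W₂}` has one in `K_W`).  Then `α(W ∩ U₁) = W ∩ U₂`: `(W.subgroupOf U₁).map α = W.subgroupOf U₂`.
(`map_ΓK_subgroupOf_eq` at `M := K_W`, `Γ_{K_W} = W`.)
[cite: NeukirchSchmidtWingberg2008, Thm (12.2.1)] [cite: NeukirchANT1999, Ch. VII Prop. (13.9)] -/
theorem map_subgroupOf_eq_of_isOpen_normal (α : U₁ ≃* U₂) (W : Subgroup (absoluteGaloisGroup ℚ))
    (hWo : IsOpen (W : Set (absoluteGaloisGroup ℚ))) (hWn : W.Normal)
    (W₂ : Subgroup (absoluteGaloisGroup ℚ))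
    (hW₂def : W₂ = ((W.subgroupOf U₁).map α.toMonoidHom).map U₂.subtype)
    (hW₂ : IsClosed (W₂ : Set (absoluteGaloisGroup ℚ)))
    (hdeg : Module.finrank ℚ (KV W) = Module.finrank ℚ (KV W₂))
    (hP₁ : ∀ v₀ : HeightOneSpectrum (𝓞 ℚ),
      (∃ P' ∈ v₀.asIdeal.primesOver (𝓞 (KV W₂)),
          P'.ramificationIdx (𝓞 ℚ) = 1 ∧ P'.inertiaDeg (𝓞 ℚ) = 1) →
        ∃ P ∈ v₀.asIdeal.primesOver (𝓞 (KV W)), P.ramificationIdx (𝓞 ℚ) = 1 ∧ P.inertiaDeg (𝓞 ℚ) = 1) :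
    (W.subgroupOf U₁).map α.toMonoidHom = W.subgroupOf U₂ := by
  haveI : FiniteDimensional ℚ (KV W) := finiteDimensional_KV W hWo
  haveI : IsGalois ℚ (KV W) := isGalois_KV_of_normal W hWo hWn
  have hV : ΓK (KV W) = W := ΓK_KV W hWo
  have h := map_ΓK_subgroupOf_eq α (KV W) W₂ (by rw [hV]; exact hW₂def) hW₂ hdeg hP₁
  rwa [hV] at h

/-- Under the same hypotheses `W = W₂`; in particular `W ≤ U₂`. [cite: NeukirchSchmidtWingberg2008, Thm (12.2.1)] -/
theorem eq_of_isOpen_normal_of_bauer (W : Subgroup (absoluteGaloisGroup ℚ))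
    (hWo : IsOpen (W : Set (absoluteGaloisGroup ℚ))) (hWn : W.Normal)
    (W₂ : Subgroup (absoluteGaloisGroup ℚ)) (hW₂ : IsClosed (W₂ : Set (absoluteGaloisGroup ℚ)))
    (hdeg : Module.finrank ℚ (KV W) = Module.finrank ℚ (KV W₂))
    (hP₁ : ∀ v₀ : HeightOneSpectrum (𝓞 ℚ),
      (∃ P' ∈ v₀.asIdeal.primesOver (𝓞 (KV W₂)),
          P'.ramificationIdx (𝓞 ℚ) = 1 ∧ P'.inertiaDeg (𝓞 ℚ) = 1) →
        ∃ P ∈ v₀.asIdeal.primesOver (𝓞 (KV W)), P.ramificationIdx (𝓞 ℚ) = 1 ∧ P.inertiaDeg (𝓞 ℚ) = 1) :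
    W = W₂ := by
  haveI : FiniteDimensional ℚ (KV W) := finiteDimensional_KV W hWo
  haveI : IsGalois ℚ (KV W) := isGalois_KV_of_normal W hWo hWn
  rw [← ΓK_KV W hWo]
  exact ΓK_eq_of_bauer (KV W) W₂ hW₂ hdeg hP₁

/-- **R6, instance-free, topological `α : U₁ ≃ₜ* U₂`** (the shape of `NeukirchUchida ℚ`): `W ≤ U₁` open
normal, `W₂ := α(W)` read in `Γ`, row-R4 data at `K_W` ⊢ `(W.subgroupOf U₁).map α = W.subgroupOf U₂`
and `W ≤ U₂` (closedness of `W₂`: `W` is closed, `Γ` compact).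
[cite: NeukirchSchmidtWingberg2008, Thm (12.2.1)] [cite: NeukirchANT1999, Ch. VII Prop. (13.9)] -/
theorem map_subgroupOf_eq_of_isOpen_normal_of_continuousMulEquiv (α : U₁ ≃ₜ* U₂)
    (W : Subgroup (absoluteGaloisGroup ℚ)) (hWo : IsOpen (W : Set (absoluteGaloisGroup ℚ)))
    (hWn : W.Normal) (hWU : W ≤ U₁) (W₂ : Subgroup (absoluteGaloisGroup ℚ))
    (hW₂def : W₂ = ((W.subgroupOf U₁).map α.toMulEquiv.toMonoidHom).map U₂.subtype)
    (hdeg : Module.finrank ℚ (KV W) = Module.finrank ℚ (KV W₂))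
    (hP₁ : ∀ v₀ : HeightOneSpectrum (𝓞 ℚ),
      (∃ P' ∈ v₀.asIdeal.primesOver (𝓞 (KV W₂)),
          P'.ramificationIdx (𝓞 ℚ) = 1 ∧ P'.inertiaDeg (𝓞 ℚ) = 1) →
        ∃ P ∈ v₀.asIdeal.primesOver (𝓞 (KV W)), P.ramificationIdx (𝓞 ℚ) = 1 ∧ P.inertiaDeg (𝓞 ℚ) = 1) :
    (W.subgroupOf U₁).map α.toMulEquiv.toMonoidHom = W.subgroupOf U₂ ∧ W ≤ U₂ := by
  have hW₂ : IsClosed (W₂ : Set (absoluteGaloisGroup ℚ)) := by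
    rw [hW₂def]
    exact isClosed_map_map_subtype_of_continuousMulEquiv α W (W.isClosed_of_isOpen hWo) hWU
  refine ⟨map_subgroupOf_eq_of_isOpen_normal α.toMulEquiv W hWo hWn W₂ hW₂def hW₂ hdeg hP₁, ?_⟩
  rw [eq_of_isOpen_normal_of_bauer W hWo hWn W₂ hW₂ hdeg hP₁, hW₂def]
  exact Subgroup.map_subtype_le _

end InstanceFree

end NeukirchUchidaProof

end Literature.AnabelianGeometry.AbsoluteAnabelian

end
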